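import Summits.QuantumFields.BalabanUV.T4Continuum.Support.ShellMeasureWilsonGaugeInvariantSUN
import Summits.QuantumFields.BalabanUV.T4Continuum.Support.ShellMeasureWilsonLedger
import Summits.QuantumFields.BalabanUV.T4Continuum.Support.ShellMeasureRegimeWitnessSUN
import Summits.QuantumFields.BalabanUV.T4Continuum.Support.ShellMeasureSmallnessArithmetic

/-!
# `T4Continuum.ShellMeasureLevelZeroBoxWitness` — rule G-1 retro-fit at level 0: THE BOX GEOMETRY OF THE LEVEL-0 FACES
# IS JOINTLY INHABITED WITH A NONEMPTY BLOCK, AND THE FACES FIRE ON IT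
(cell `pub-balaban`, sub-cell `t4`, spine estimate NE7c (node U5b); NE7c ROUND-2 crew, unit
`b2b-balaban-t4-ne7c-formalise-leaf-10` gen 11; journal OFFER «RULE G-1 RETRO-FIT AT LEVEL 0»; owner table
`t4/b2b-balaban-t4-ne7c-p1/LEAVES-NE7c-P1.md` v3.7 — CREW RULE G-1 (R-ne7cp1-g32-3 (a)(2): every END-level composition over a
GEOMETRIC hypothesis family ships a joint-inhabitation example with a NONEMPTY index set; motivated by FINDING F-ne7cleaf02g9-1);
rows concerned: the owner's S11 `ShellMeasureWilsonGaugeInvariant.slotAntiConcentration_wilson_su2_gaugeInvariant` (p207446; the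
level-0 face consumed by S19 `levelLedger_wilson_su2_levelZero` ∕ `ShellMeasureRootCompositionLevelZero`) and this lineage's
`SU(N)` twin S44 `ShellMeasureWilsonGaugeInvariantSUN.slotAntiConcentration_wilson_suN_gaugeInvariant` (p217538); ADDITIVE —
imports S44 (hence S11), S19 `ShellMeasureWilsonLedger`, S21 `ShellMeasureSmallnessArithmetic`, `ShellMeasureRegimeWitnessSUN`
ONLY; [folklore]; five DATA `def`s (`blockBonds`, `boxPlaqF`, `exteriorPlaqs`, `weightPlaqs`, `toyParams`), 0 `def … : Prop`,
0 sorry, 0 citation tags)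

HONEST FRAMING.  Finite four-torus programme, rung (B)+1 only — NOT infinite volume, NOT a mass gap, NOT the Clay
problem, NOT summit progress; (B), `BetaPertHyp`, (B^μ) not consumed.  NE7c (`T4IndicatorShell.ShellWeightBound`) is NOT
PRINTED in [Balaban 1983–89] and NOT PROVED; «NE7c ⇐ the named binders» (trigger c3, WALL `t4/b2b-balaban-t4-ne7c-p1/WALL-NE7c-P1.md`
§2b).  (M1)₀ realized ≠ NE7c; the level-0 face serves comparisons `K ≤ N₁` only.  This file is a CONSISTENCY CERTIFICATE of the
GEOMETRIC hypothesis family of OUR level-0 faces — nothing of Bałaban's, no estimate, nothing printed asserted or cited.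
HONEST DEPENDENCY (cell): continuum YM on T⁴ ⇐ BetaPertH ∧ nine spine estimates (0/9 proved); BetaPertH ⇐ (D1) ∧ (D4) ∧
CAP+tail; G-an2-4 gates asym, D1 and NE2/3/4.

THE POINT.  The level-0 faces S11 ∕ S44 ∕ S19 §1 take a GEOMETRIC hypothesis family no file had instantiated on a concrete torus
box: a NON-WRAPPING box `[lo, hi] ⊂ ℤ^d` read on `T^{(j)}` through `castSite` (`hN`), of side `≤ m` (`hm`), a block `Λ` of box
bonds (`hΛbox`) DISJOINT from the axial comb (`hΛcomb`) and COVERING the box off the comb (`hcov`), a NONEMPTY set `P_u` of box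
plaquettes (`hPu`, `hPubox`, S19: `hboxPu`), an exterior ∕ weight split of the action's plaquettes (S19: `hPext`, `hdisj`, `hall`)
and a chart enumeration `e : ↥Λ × Fin 3 ≃ Fin n`.  (S10 `ShellMeasureWilsonToy` is the toy of the ABSTRACT block theorem — word
data, no box; S21 ∕ `ShellMeasureRegimeWitnessSUN` witness the NUMERIC regime only.)  Here:
* §1 the CANONICAL data — `blockBonds lo hi` (box bonds off the comb), `boxPlaqF lo hi` (box plaquettes as a `Finset`),
  `exteriorPlaqs Λ P_all` ∕ `weightPlaqs Λ P_all` (the split) — meet `hΛbox`, `hΛcomb`, `hcov`, `hPubox`, `hboxPu`, `hPext`,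
  `hdisj`, `hall` at EVERY corner, side and plaquette set (filter bookkeeping);
* §2 NONEMPTINESS: on a non-wrapping box containing the unit square `lo + e_{i₀} + e_{i₁} ≤ hi` (`i₀ < i₁`) the bond
  `⟨lo + e_{i₀}, i₁⟩` is a box bond OFF the comb (`blockBonds_nonempty` — via `castSite_injOn_box`, i.e. it NEEDS non-wrapping)
  and `⟨castSite lo, i₀, i₁⟩` is a box plaquette (`boxPlaqF_nonempty`); the side-2 box of any torus with `2 ≤ d`,
  `3 ≤ sitesPerDir j` qualifies (`side_two_nonwrapping`, `side_two_side`, `side_two_square`);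
* §3 THE FACES FIRED BY NAME: **`levelZero_face_suN_inhabited`** — for EVERY `N ≥ 1`, EVERY torus `T^{(j)}` with `2 ≤ d`,
  `3 ≤ sitesPerDir j`, every corner, `β ≥ 0`, `P_w`: numbers `S, σ, θ, δ, ρ` with the live shell BELOW the co-test
  (`θ(1−ρ) < σ`) such that S44's (M1)₀ HOLDS on the NONEMPTY block `blockBonds lo (lo+2)` with the NONEMPTY classifier set
  (numbers from `ShellMeasureRegimeWitnessSUN.levelZero_regime_exists N d 2`); **`levelZero_face_su2_inhabited`** — the owner's
  S11 at the CONCRETE torus `toyParams` (`d = 2`, `L = 3`, `m = 1`, `K = 0`: six sites per direction), level `0`, corner `0`,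
  `e := Fintype.equivFin`, EXPLICIT numbers `S = 10⁻⁴`, `σ = θ = 2·10⁻⁵`, `δ = ½`, `ρ = ¼` (S21 `sm0_of_window` for (SM)₀;
  `θ(1−ρ) = 1.5·10⁻⁵ < σ`); **`levelZero_gibbs_face_su2_inhabited`** — S19 §1's face of the FULL GIBBS MEASURE
  `e^{−β Σ_{P_all}(1 − Re tr U(∂p))} dU` (NO window, NO co-test in the measure) on the same data, for EVERY finite `P_all`;
* §4 the realized densities are NOT the zero density: `giF … 1 ≠ 0` for every `σ > 0` (`giF_su2_one_ne_zero`, `…_suN_…`).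
NOT HERE: positive realized MASS of the shell (the measure-level half of non-vacuity — row S88's business at the live level).
NOTHING in the countdown moves; NE7c NOT PROVED; spine PROVED 0∕9.
-/

noncomputable section

open Set Function MeasureTheory

namespace Summit.QuantumFields.BalabanUV.T4Continuum.ShellMeasureLevelZeroBoxWitness

open scoped ENNReal
open Literature.MathematicalPhysics.QuantumFieldTheory.Balaban1983to89
open T4ShellMeasure (SlotAntiConcentration)
open T4AxialGaugeFixing (combBonds combSet mem_combBonds combSet_subset_boxBonds)
open T4AxialGaugeSmallField (castSite castSite_injOn_box boxPlaqs boxBonds)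
open B7Prop1Explicit (e e_apply)
open B8Lemma1NonAbelian (lowPart lowPart_apply e_nonneg)

/-! ## §1 The canonical block data of a box -/

section BlockData

variable {P : Params} {j : ℕ} (lo hi : Fin P.d → ℤ)

open Classical in
/-- THE BLOCK OF A BOX: the torus bonds of the box `[lo, hi]` that are NOT on the axial comb — the integration variables left
after the tree gauge (S11's `Λ` with `hΛbox`, `hΛcomb`, `hcov`). [folklore] -/
def blockBonds : Finset (PBond P j) :=
  Finset.univ.filter fun b => b ∈ boxBonds lo hi ∧ b ∉ (combSet lo hi : Set (PBond P j))

open Classical in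
/-- THE BOX PLAQUETTES AS A `Finset` (S11's classifier set `P_u` with `hPubox`). [folklore] -/
def boxPlaqF : Finset (Plaq P j) :=
  Finset.univ.filter fun p => p ∈ boxPlaqs lo hi

variable {lo hi}

/-- membership in the block, unfolded. [folklore] -/
theorem mem_blockBonds {b : PBond P j} :
    b ∈ blockBonds lo hi ↔ b ∈ boxBonds lo hi ∧ b ∉ (combSet lo hi : Set (PBond P j)) := by
  classical
  simp only [blockBonds, Finset.mem_filter, Finset.mem_univ, true_and]

/-- membership in the plaquette set, unfolded. [folklore] -/
theorem mem_boxPlaqF {p : Plaq P j} : p ∈ boxPlaqF lo hi ↔ p ∈ boxPlaqs lo hi := by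
  classical
  simp only [boxPlaqF, Finset.mem_filter, Finset.mem_univ, true_and]

variable (lo hi)

/-- `hΛbox`: the block consists of box bonds. [folklore] -/
theorem blockBonds_box : ∀ b ∈ (blockBonds lo hi : Finset (PBond P j)), b ∈ boxBonds lo hi :=
  fun _ hb => (mem_blockBonds.1 hb).1

/-- `hΛcomb`: the block is disjoint from the axial comb. [folklore] -/
theorem disjoint_blockBonds_comb : Disjoint (blockBonds lo hi : Finset (PBond P j)) (combBonds lo hi) := by
  rw [Finset.disjoint_left]
  intro b hb hc
  exact (mem_blockBonds.1 hb).2 (mem_combBonds.1 hc)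

/-- `hcov`: a box bond off the block is a comb bond. [folklore] -/
theorem cover_blockBonds :
    ∀ b ∈ (boxBonds lo hi : Set (PBond P j)), b ∉ blockBonds lo hi → b ∈ (combBonds lo hi : Finset (PBond P j)) := by
  intro b hb hnot
  rw [mem_combBonds]
  by_contra hc
  exact hnot (mem_blockBonds.2 ⟨hb, hc⟩)

/-- `hPubox`: the plaquette set consists of box plaquettes. [folklore] -/
theorem boxPlaqF_box : ∀ p ∈ (boxPlaqF lo hi : Finset (Plaq P j)), p ∈ boxPlaqs lo hi := fun _ hp => mem_boxPlaqF.1 hp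

/-- `hboxPu` of the level-0 LEDGER (S19 `levelLedger_wilson_su2_levelZero`): every box plaquette is in the plaquette set
(indeed `boxPlaqF` IS the set of box plaquettes). [folklore] -/
theorem boxPlaqs_subset_boxPlaqF : boxPlaqs lo hi ⊆ (↑(boxPlaqF lo hi : Finset (Plaq P j)) : Set (Plaq P j)) :=
  fun _ hp => Finset.mem_coe.2 (mem_boxPlaqF.2 hp)

/-- THE EXTERIOR PLAQUETTES of a plaquette set `P_all` relative to a block `Λ`: those with NO bond in `Λ` (S19's `P_ext`).
[folklore] -/
def exteriorPlaqs [DecidableEq (PBond P j)] (Λ : Finset (PBond P j)) (Pall : Finset (Plaq P j)) : Finset (Plaq P j) :=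
  Pall.filter fun p => (⟨p.src, p.μ⟩ : PBond P j) ∉ Λ ∧ (⟨p.src.shift p.μ, p.ν⟩ : PBond P j) ∉ Λ ∧
    (⟨p.src.shift p.ν, p.μ⟩ : PBond P j) ∉ Λ ∧ (⟨p.src, p.ν⟩ : PBond P j) ∉ Λ

/-- THE WEIGHT PLAQUETTES of `P_all` relative to `Λ`: those with SOME bond in `Λ` (S19's `P_w`). [folklore] -/
def weightPlaqs [DecidableEq (PBond P j)] (Λ : Finset (PBond P j)) (Pall : Finset (Plaq P j)) : Finset (Plaq P j) :=
  Pall.filter fun p => ¬ ((⟨p.src, p.μ⟩ : PBond P j) ∉ Λ ∧ (⟨p.src.shift p.μ, p.ν⟩ : PBond P j) ∉ Λ ∧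
    (⟨p.src.shift p.ν, p.μ⟩ : PBond P j) ∉ Λ ∧ (⟨p.src, p.ν⟩ : PBond P j) ∉ Λ)

/-- `hPext`: exterior plaquettes have no bond in the block. [folklore] -/
theorem exteriorPlaqs_spec [DecidableEq (PBond P j)] (Λ : Finset (PBond P j)) (Pall : Finset (Plaq P j)) :
    ∀ p ∈ exteriorPlaqs Λ Pall, (⟨p.src, p.μ⟩ : PBond P j) ∉ Λ ∧ (⟨p.src.shift p.μ, p.ν⟩ : PBond P j) ∉ Λ ∧
      (⟨p.src.shift p.ν, p.μ⟩ : PBond P j) ∉ Λ ∧ (⟨p.src, p.ν⟩ : PBond P j) ∉ Λ :=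
  fun _ hp => (Finset.mem_filter.1 hp).2

/-- `hdisj`: the exterior and weight plaquettes are disjoint. [folklore] -/
theorem disjoint_exterior_weight [DecidableEq (PBond P j)] (Λ : Finset (PBond P j)) (Pall : Finset (Plaq P j)) :
    Disjoint (exteriorPlaqs Λ Pall) (weightPlaqs Λ Pall) :=
  Finset.disjoint_filter_filter_not Pall Pall _

/-- `hall`: exterior ∪ weight = the whole plaquette set. [folklore] -/
theorem exterior_union_weight [DecidableEq (PBond P j)] [DecidableEq (Plaq P j)] (Λ : Finset (PBond P j))
    (Pall : Finset (Plaq P j)) : exteriorPlaqs Λ Pall ∪ weightPlaqs Λ Pall = Pall :=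
  Finset.filter_union_filter_not_eq _ Pall

end BlockData

/-! ## §2 Nonemptiness on a non-wrapping box containing a unit square -/

section Nonempty

variable {P : Params} {j : ℕ} {lo hi : Fin P.d → ℤ}

/-- `0 ≤ (e_i)_κ` — bookkeeping. [folklore] -/
theorem e_apply_nonneg (i κ : Fin P.d) : (0 : ℤ) ≤ e i κ := by simpa only [Pi.zero_apply] using e_nonneg i κ

/-- `lo ≤ lo + e_i` — bookkeeping. [folklore] -/
theorem le_add_e (lo : Fin P.d → ℤ) (i : Fin P.d) : lo ≤ lo + e i := fun κ => by
  simpa only [Pi.add_apply] using le_add_of_nonneg_right (e_apply_nonneg (P := P) i κ)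

/-- **THE BLOCK IS NONEMPTY**: on a NON-WRAPPING box containing the unit square `lo + e_{i₀} + e_{i₁} ≤ hi` with `i₀ < i₁`,
the bond `⟨castSite (lo + e_{i₀}), i₁⟩` is a box bond off the axial comb (its offset from the corner has the nonzero low
component `(e_{i₀})_{i₀} = 1` below `i₁`; non-wrapping makes the box preimage of its source unique). [folklore] -/
theorem blockBonds_nonempty (hN : ∀ κ, hi κ - lo κ < P.sitesPerDir j) {i₀ i₁ : Fin P.d} (h01 : i₀ < i₁)
    (hsq : lo + e i₀ + e i₁ ≤ hi) : (blockBonds lo hi : Finset (PBond P j)).Nonempty := by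
  refine ⟨⟨castSite (lo + e i₀), i₁⟩, mem_blockBonds.2 ⟨⟨lo + e i₀, le_add_e lo i₀, hsq, rfl⟩, ?_⟩⟩
  rintro ⟨x, hlox, hxhi, hsrc, hlow⟩
  -- the box preimage of the source is unique: `x = lo + e i₀`
  have hxle : x ≤ hi := fun κ => by
    have h1 := hxhi κ; simp only [Pi.add_apply] at h1; linarith [e_apply_nonneg (P := P) i₁ κ]
  have hle' : lo + e i₀ ≤ hi := fun κ => by
    have h1 := hsq κ; simp only [Pi.add_apply] at h1 ⊢; linarith [e_apply_nonneg (P := P) i₁ κ]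
  have hx : x = lo + e i₀ :=
    castSite_injOn_box hN hlox hxle (le_add_e lo i₀) hle' hsrc.symm
  -- but its low part below `i₁` is not zero
  have h := congr_fun hlow i₀
  rw [hx, lowPart_apply, if_pos h01] at h
  simp [e_apply] at h

/-- **THE CLASSIFIER SET IS NONEMPTY**: `⟨castSite lo, i₀, i₁⟩` (`i₀ < i₁`) is a box plaquette as soon as
`lo + e_{i₀} + e_{i₁} ≤ hi`. [folklore] -/
theorem boxPlaqF_nonempty {i₀ i₁ : Fin P.d} (h01 : i₀ < i₁) (hsq : lo + e i₀ + e i₁ ≤ hi) :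
    (boxPlaqF lo hi : Finset (Plaq P j)).Nonempty :=
  ⟨⟨castSite lo, i₀, i₁, h01⟩, mem_boxPlaqF.2 ⟨lo, le_rfl, hsq, rfl⟩⟩

/-- the first two directions of a lattice of dimension `≥ 2`. [folklore] -/
theorem dir_zero_lt_one (hd : 2 ≤ P.d) :
    (⟨0, by omega⟩ : Fin P.d) < ⟨1, by omega⟩ := Fin.mk_lt_mk.2 (by norm_num)

/-- THE SIDE-2 BOX DOES NOT WRAP on a torus with at least three sites per direction. [folklore] -/
theorem side_two_nonwrapping (h3 : 3 ≤ P.sitesPerDir j) (lo : Fin P.d → ℤ) :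
    ∀ κ, (fun κ => lo κ + 2) κ - lo κ < (P.sitesPerDir j : ℤ) := fun κ => by
  have : (3 : ℤ) ≤ (P.sitesPerDir j : ℤ) := by exact_mod_cast h3
  simp only; linarith

/-- the side-2 box has side `≤ 2` (`hm` with `m = 2`). [folklore] -/
theorem side_two_side (lo : Fin P.d → ℤ) : ∀ κ, (fun κ => lo κ + 2) κ ≤ lo κ + ((2 : ℕ) : ℤ) := fun κ => by
  simp only [Nat.cast_ofNat]; exact le_rfl

/-- the side-2 box contains the unit square at its corner in any two directions. [folklore] -/
theorem side_two_square (lo : Fin P.d → ℤ) (i₀ i₁ : Fin P.d) (h01 : i₀ < i₁) :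
    lo + e i₀ + e i₁ ≤ fun κ => lo κ + 2 := fun κ => by
  simp only [Pi.add_apply, e_apply]
  have hne : i₀ ≠ i₁ := ne_of_lt h01
  split_ifs with h1 h2 <;> omega

end Nonempty

/-! ## §3 The level-0 faces fired on the canonical block data -/

section FaceSUN

open scoped Matrix.Norms.L2Operator
open ShellMeasureExpChartSUN (SUN dimSU)
open ShellMeasureWilsonRealizedSUN (wilsonU)
open ShellMeasureWilsonGaugeInvariantSUN (giF slotAntiConcentration_wilson_suN_gaugeInvariant)
open ShellMeasureRegimeWitnessSUN (levelZero_regime_exists)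

variable {P : Params} {j : ℕ} [DecidableEq (PBond P j)]

/-- **THE `SU(N)` LEVEL-0 FACE (S44) FIRES ON A NONEMPTY BLOCK, EVERY `N`, EVERY TORUS WITH `d ≥ 2` AND `≥ 3` SITES PER
DIRECTION, EVERY CORNER.**  With `hi := lo + 2`, `Λ := blockBonds lo hi` (NONEMPTY), `P_u := boxPlaqF lo hi` (NONEMPTY), any
`β ≥ 0` and any `P_w`: there are numbers `S, σ, θ, δ, ρ` with `0 < θ`, `0 ≤ ρ < 1` and the live shell below the co-test threshold
`θ(1−ρ) < σ` such that S44's conclusion — (M1)₀ for `(fieldMeasure P j SU(N)).withDensity (giF lo hi σ β P_w)` and the classifier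
`wilsonU` over `P_u`, constant `2(#Λ·dim SU(N) + β·Σ_{P_w} 4S(8 + 16S))∕(1−δ)` — HOLDS: every hypothesis of
`slotAntiConcentration_wilson_suN_gaugeInvariant` is met by §1–§2 and `levelZero_regime_exists N d 2`. [folklore] -/
theorem levelZero_face_suN_inhabited (N : ℕ) [NeZero N] (hd : 2 ≤ P.d) (h3 : 3 ≤ P.sitesPerDir j)
    (lo : Fin P.d → ℤ) {β : ℝ} (hβ : 0 ≤ β) (Pw : Finset (Plaq P j)) :
    (blockBonds lo (fun κ => lo κ + 2) : Finset (PBond P j)).Nonempty ∧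
    ∃ hPu : (boxPlaqF lo (fun κ => lo κ + 2) : Finset (Plaq P j)).Nonempty,
    ∃ S σ θ δ ρ : ℝ, 0 < θ ∧ 0 ≤ ρ ∧ ρ < 1 ∧ δ < 1 ∧ θ * (1 - ρ) < σ ∧
      SlotAntiConcentration
        ((fieldMeasure P j (SUN N)).withDensity (giF (N := N) lo (fun κ => lo κ + 2) σ β Pw))
        (wilsonU (N := N) hPu) θ ρ
        (2 * ((((blockBonds lo (fun κ => lo κ + 2) : Finset (PBond P j)).card * dimSU N : ℕ) : ℝ) +
          β * ∑ _p ∈ Pw, (4 * S) * (8 + 4 * (4 * S))) / (1 - δ)) := by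
  have h01 := dir_zero_lt_one hd
  have hsq := side_two_square lo _ _ h01
  have hN := side_two_nonwrapping h3 lo
  have hPu := boxPlaqF_nonempty (P := P) (j := j) h01 hsq
  refine ⟨blockBonds_nonempty hN h01 hsq, hPu, ?_⟩
  obtain ⟨S, σ, θ, δ, ρ, Rad, hS0, hS4, hσ, hN4, hrad, hθ, hδ0, hδ1, hρ0, hρ, hRad, hSM, hSMσ, hlive⟩ :=
    levelZero_regime_exists N P.d 2
  refine ⟨S, σ, θ, δ, ρ, hθ, hρ0, by linarith, hδ1, hlive, ?_⟩
  exact slotAntiConcentration_wilson_suN_gaugeInvariant hN (side_two_side lo) (blockBonds lo _) (blockBonds_box lo _)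
    (disjoint_blockBonds_comb lo _) (cover_blockBonds lo _) hS0 hS4 hσ hN4 hrad hPu (boxPlaqF_box lo _) Pw hβ hθ hδ0 hδ1
    hρ0 hρ hRad hSM hSMσ

end FaceSUN

section FaceSU2

open scoped Matrix.Norms.L2Operator
open T4CubeChartGnomonic (SU2)
open ShellMeasureWilsonRealizedSU2 (wilsonU)
open ShellMeasureWilsonGaugeInvariant (giF slotAntiConcentration_wilson_su2_gaugeInvariant)
open ShellMeasureSmallnessArithmetic (sm0_of_window)
open ShellMeasureWilsonLedger (slotAntiConcentration_wilson_su2_gibbs_of_union)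

/-- A CONCRETE torus parameter set: `d = 2`, `L = 3`, `m = 1`, `K = 0` — the unit lattice `T^{(0)}` has `2·3 = 6` sites per
direction. [folklore] -/
def toyParams : Params where
  d := 2
  L := 3
  m := 1
  K := 0
  hd := by norm_num
  hL := ⟨⟨1, rfl⟩, by norm_num⟩

/-- six sites per direction at level `0`. [folklore] -/
theorem toyParams_sitesPerDir : toyParams.sitesPerDir 0 = 6 := by
  simp [Params.sitesPerDir, toyParams]

/-- **THE OWNER's `SU(2)` LEVEL-0 FACE (S11) FIRES ON A CONCRETE NONEMPTY BLOCK WITH EXPLICIT NUMBERS.**  On the torus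
`toyParams` (`d = 2`, six sites per direction) at level `0`, corner `0`, side-2 box, `Λ := blockBonds 0 2` (NONEMPTY), `P_u :=
boxPlaqF 0 2` (NONEMPTY), `e := Fintype.equivFin`, and `S = 10⁻⁴`, `σ = θ = 2·10⁻⁵`, `δ = ½`, `ρ = ¼` (live shell below the
co-test: `θ(1−ρ) = 1.5·10⁻⁵ < σ`): S11's (M1)₀ HOLDS for every `β ≥ 0` and `P_w` — every hypothesis of
`slotAntiConcentration_wilson_su2_gaugeInvariant` met (`hrad`: `1·2·σ ≤ 2S∕π` from `π ≤ 4`; the two (SM)₀ by S21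
`sm0_of_window`). [folklore] -/
theorem levelZero_face_su2_inhabited [DecidableEq (PBond toyParams 0)] {β : ℝ} (hβ : 0 ≤ β)
    (Pw : Finset (Plaq toyParams 0)) :
    (blockBonds (P := toyParams) (j := 0) 0 (fun _ => (0 : ℤ) + 2)).Nonempty ∧
    ∃ hPu : (boxPlaqF (P := toyParams) (j := 0) 0 (fun _ => (0 : ℤ) + 2)).Nonempty,
      (2 / 10 ^ 5 : ℝ) * (1 - 1 / 4) < 2 / 10 ^ 5 ∧
      SlotAntiConcentration
        ((fieldMeasure toyParams 0 SU2).withDensity (giF 0 (fun _ => (0 : ℤ) + 2) (2 / 10 ^ 5) β Pw))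
        (wilsonU hPu) (2 / 10 ^ 5) (1 / 4)
        (2 * (((Fintype.card (↥(blockBonds (P := toyParams) (j := 0) 0 (fun _ => (0 : ℤ) + 2)) × Fin 3) : ℕ) : ℝ) +
          β * ∑ _p ∈ Pw, (8 * (1 / 10 ^ 4 : ℝ)) * (8 + 4 * (8 * (1 / 10 ^ 4 : ℝ)))) / (1 - 1 / 2)) := by
  have hd : 2 ≤ toyParams.d := le_rfl
  have h3 : 3 ≤ toyParams.sitesPerDir 0 := by rw [toyParams_sitesPerDir]; norm_num
  have h01 := dir_zero_lt_one hd
  have hsq := side_two_square (P := toyParams) (0 : Fin toyParams.d → ℤ) _ _ h01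
  have hN := side_two_nonwrapping (j := 0) h3 (0 : Fin toyParams.d → ℤ)
  have hPu := boxPlaqF_nonempty (P := toyParams) (j := 0) h01 hsq
  refine ⟨blockBonds_nonempty hN h01 hsq, hPu, by norm_num, ?_⟩
  have hπ4 := Real.pi_le_four
  have hπ3 := Real.pi_gt_three
  have hrad : ((toyParams.d - 1 : ℕ) : ℝ) * (2 : ℕ) * (2 / 10 ^ 5 : ℝ) ≤ 2 * (1 / 10 ^ 4) / Real.pi := by
    rw [le_div_iff₀ Real.pi_pos]
    simp only [toyParams, Nat.cast_ofNat]
    norm_num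
    nlinarith
  have hSM : 4 * (8 * (1 / 10 ^ 4 : ℝ)) ^ 2 * Real.exp (2 * (8 * (1 / 10 ^ 4 : ℝ))) ≤ 1 / 2 * (2 / 10 ^ 5) :=
    sm0_of_window (by norm_num) (by norm_num)
  exact slotAntiConcentration_wilson_su2_gaugeInvariant hN (side_two_side (P := toyParams) 0)
    (blockBonds 0 _) (blockBonds_box 0 _) (disjoint_blockBonds_comb 0 _) (cover_blockBonds 0 _) (Fintype.equivFin _)
    (by norm_num) (by norm_num) (by nlinarith) (by norm_num) hrad hPu (boxPlaqF_box 0 _) Pw hβ (by norm_num) (by norm_num)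
    (by norm_num) (by norm_num) (by norm_num) hSM hSM

/-- **THE LEVEL-0 FACE OF THE FULL `SU(2)` GIBBS MEASURE (S19 §1 `slotAntiConcentration_wilson_su2_gibbs_of_union`) FIRES
ON THE SAME CONCRETE DATA, FOR EVERY FINITE PLAQUETTE SET `P_all`** (e.g. all plaquettes of the torus: the honest level-0 Gibbs
law `e^{−β Σ_{P_all}(1 − Re tr U(∂p))} dU`, NO window, NO co-test in the measure): torus `toyParams`, level `0`, corner `0`,
side-2 box, `Λ := blockBonds 0 2` (NONEMPTY), `P_u := boxPlaqF 0 2` (NONEMPTY, and ⊇ the box plaquettes: `hboxPu`),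
`P_ext ∕ P_w :=` the split of `P_all` by `Λ` (§1), `S = 10⁻⁴`, `σ = θ = 2·10⁻⁵` (`θ ≤ σ`), `δ = ½`, `ρ = ¼`: (M1)₀ for the Gibbs
law with the classifier `wilsonU` over `P_u` and the constant `2(#(Λ × Fin 3) + β·Σ_{P_w} 8S(8 + 32S))∕(1 − ½)`. [folklore] -/
theorem levelZero_gibbs_face_su2_inhabited [DecidableEq (PBond toyParams 0)] [DecidableEq (Plaq toyParams 0)] {β : ℝ}
    (hβ : 0 ≤ β) (Pall : Finset (Plaq toyParams 0)) :
    (blockBonds (P := toyParams) (j := 0) 0 (fun _ => (0 : ℤ) + 2)).Nonempty ∧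
    ∃ hPu : (boxPlaqF (P := toyParams) (j := 0) 0 (fun _ => (0 : ℤ) + 2)).Nonempty,
      (2 / 10 ^ 5 : ℝ) * (1 - 1 / 4) < 2 / 10 ^ 5 ∧
      SlotAntiConcentration
        ((fieldMeasure toyParams 0 SU2).withDensity fun U =>
          ENNReal.ofReal (Real.exp (-(β * ∑ p ∈ Pall, (1 - reTr (GaugeField.plaqHol U p))))))
        (wilsonU hPu) (2 / 10 ^ 5) (1 / 4)
        (2 * (((Fintype.card (↥(blockBonds (P := toyParams) (j := 0) 0 (fun _ => (0 : ℤ) + 2)) × Fin 3) : ℕ) : ℝ) +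
          β * ∑ _p ∈ weightPlaqs (blockBonds (P := toyParams) (j := 0) 0 (fun _ => (0 : ℤ) + 2)) Pall,
            (8 * (1 / 10 ^ 4 : ℝ)) * (8 + 4 * (8 * (1 / 10 ^ 4 : ℝ)))) / (1 - 1 / 2)) := by
  have hd : 2 ≤ toyParams.d := le_rfl
  have h3 : 3 ≤ toyParams.sitesPerDir 0 := by rw [toyParams_sitesPerDir]; norm_num
  have h01 := dir_zero_lt_one hd
  have hsq := side_two_square (P := toyParams) (0 : Fin toyParams.d → ℤ) _ _ h01
  have hN := side_two_nonwrapping (j := 0) h3 (0 : Fin toyParams.d → ℤ)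
  have hPu := boxPlaqF_nonempty (P := toyParams) (j := 0) h01 hsq
  refine ⟨blockBonds_nonempty hN h01 hsq, hPu, by norm_num, ?_⟩
  have hπ4 := Real.pi_le_four
  have hπ3 := Real.pi_gt_three
  have hrad : ((toyParams.d - 1 : ℕ) : ℝ) * (2 : ℕ) * (2 / 10 ^ 5 : ℝ) ≤ 2 * (1 / 10 ^ 4) / Real.pi := by
    rw [le_div_iff₀ Real.pi_pos]
    simp only [toyParams, Nat.cast_ofNat]
    norm_num
    nlinarith
  have hSM : 4 * (8 * (1 / 10 ^ 4 : ℝ)) ^ 2 * Real.exp (2 * (8 * (1 / 10 ^ 4 : ℝ))) ≤ 1 / 2 * (2 / 10 ^ 5) :=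
    sm0_of_window (by norm_num) (by norm_num)
  exact slotAntiConcentration_wilson_su2_gibbs_of_union hN (side_two_side (P := toyParams) 0)
    (blockBonds 0 _) (blockBonds_box 0 _) (disjoint_blockBonds_comb 0 _) (cover_blockBonds 0 _) (Fintype.equivFin _)
    (by norm_num) (by norm_num) (by nlinarith) (by norm_num) hrad hPu (boxPlaqF_box 0 _) (boxPlaqs_subset_boxPlaqF 0 _)
    (weightPlaqs (blockBonds 0 _) Pall) (exteriorPlaqs (blockBonds 0 _) Pall) Pall hβ (by norm_num) le_rfl (by norm_num)
    (by norm_num) (by norm_num) (by norm_num) hSM hSM (exteriorPlaqs_spec _ _) (disjoint_exterior_weight _ _)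
    (exterior_union_weight _ _)

end FaceSU2

/-! ## §4 The realized densities are not the zero density -/

section NonZero

open scoped Matrix.Norms.L2Operator
open T4CubeChartGnomonic (SU2)
open ShellMeasureExpChartSUN (SUN)
open T4SmallFieldWindowSandwich (plaqSmallOn_one)

variable {P : Params} {j : ℕ} (lo hi : Fin P.d → ℤ)

/-- **THE GAUGE-INVARIANT `SU(2)` DENSITY IS NOT THE ZERO DENSITY**: at the trivial configuration the co-test holds (every
plaquette variable is `1`, `T4SmallFieldWindowSandwich.plaqSmallOn_one`) and the Wilson weight is positive, so
`giF lo hi σ β P_w 1 ≠ 0` for every `σ > 0`. [folklore] -/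
theorem giF_su2_one_ne_zero {σ : ℝ} (hσ : 0 < σ) (β : ℝ) (Pw : Finset (Plaq P j)) :
    ShellMeasureWilsonGaugeInvariant.giF lo hi σ β Pw (1 : GaugeField P j SU2) ≠ 0 := by
  have hmem : (1 : GaugeField P j SU2) ∈ ShellMeasureWilsonGaugeInvariant.boxTest lo hi σ :=
    plaqSmallOn_one _ hσ
  unfold ShellMeasureWilsonGaugeInvariant.giF
  rw [Set.indicator_of_mem hmem, Pi.one_apply, one_mul]
  exact (ENNReal.ofReal_pos.2 (Real.exp_pos _)).ne'

/-- **THE GAUGE-INVARIANT `SU(N)` DENSITY IS NOT THE ZERO DENSITY** (same argument). [folklore] -/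
theorem giF_suN_one_ne_zero (N : ℕ) [NeZero N] {σ : ℝ} (hσ : 0 < σ) (β : ℝ) (Pw : Finset (Plaq P j)) :
    ShellMeasureWilsonGaugeInvariantSUN.giF (N := N) lo hi σ β Pw (1 : GaugeField P j (SUN N)) ≠ 0 := by
  have hmem : (1 : GaugeField P j (SUN N)) ∈ ShellMeasureWilsonGaugeInvariantSUN.boxTest (N := N) lo hi σ :=
    plaqSmallOn_one _ hσ
  unfold ShellMeasureWilsonGaugeInvariantSUN.giF
  rw [Set.indicator_of_mem hmem, Pi.one_apply, one_mul]
  exact (ENNReal.ofReal_pos.2 (Real.exp_pos _)).ne'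

end NonZero

end Summit.QuantumFields.BalabanUV.T4Continuum.ShellMeasureLevelZeroBoxWitness

end
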